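import Summits.Ventures.LatticeQCDFlow.Scaling.RegenerationTagChain

/-!
HONEST FRAMING: exact (Metropolis-corrected) sampling algorithms for lattice gauge theory; figures
of merit are autocorrelation/cost numbers at stated couplings and volumes; no continuum-physics
claim.

# RegenerationTagDecay — THE TUNED CONSTANTS OF THE REGENERATION TAG CHAIN: `P(D_n ≠ ∅) ≤ ((2K+p)/p)·(1 − tcp/(2m))ⁿ`
# ONCE `4t ≤ p(1−t)w₀` (ONE-SIDED DOMINATION `p`, ANY REVERSE CONSTANT `q`), AND `≤ 2(K+1)·(1 − t(1−t)w₀c/(2m))ⁿ` FOR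
# `p = q = 1` (PERFECT TRANSPORTS, HOT WEIGHT `w₀`); HENCE `≤ ε` AFTER `(2m/(tcp))·log((2K+p)/(pε))`, RESP.
# `(2m/(t(1−t)w₀c))·log(2(K+1)/ε)` STEPS (lean-2 GEN-25, ours)

Venture-side (OURS).  Cell `lqcd-flow` (pub-lqcd), unit `pub-lqcd-lean-2-g25`, 2026-08-27.  Chapter M (the
coupon-collector ceiling without perfect transports), file 2: the drift inequality of `Scaling/RegenerationTagChain`
(`QΦ ≤ (1−ρ)Φ` for `Φ(D) = b·𝟙{0∈D} + #{k∈D : k≠0}` under `0 < b ≤ p`, `ρ ≤ tc(p−b)/m`,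
`ρb ≤ (1−t)w₀b − t(1−qb)`, `ρ ≤ t(1−qb)c/m`) is instantiated twice.

## What is proved

* §1 **`regen_nonempty_le_oneSided`** — `0 < p ≤ 1`, `0 ≤ q ≤ 1`, `4t ≤ p(1−t)w₀`, hub multiplicities `≥ c ≥ 1`:
  `(δ_{univ} Qⁿ){D ≠ ∅} ≤ ((2K+p)/p)·(1 − t·c·p/(2m))ⁿ` (`b = p/2`, `ρ = tcp/(2m)`);
  **`regen_nonempty_le_perfect`** — `p = q = 1`, `0 < t < 1`, `0 < w₀ ≤ 1`:
  `(δ_{univ} Qⁿ){D ≠ ∅} ≤ 2(K+1)·(1 − t(1−t)w₀c/(2m))ⁿ` (`b = 1 − (1−t)w₀/2`; at `w₀ = 1` the rate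
  `t(1−t)c/(2m)` of `Scaling/DirtySetDecay`, whose chain this is).
* §2 `geom_le_of_ge_log` (`C(1−a)ⁿ ≤ ε` once `n ≥ (1/a)·log(C/ε)`) and the `log`-forms
  **`regen_nonempty_le_oneSided_of_ge_log`** (`n ≥ (2m/(tcp))·log((2K+p)/(pε))`),
  **`regen_nonempty_le_perfect_of_ge_log`** (`n ≥ (2m/(t(1−t)w₀c))·log(2(K+1)/ε)`).

Reading (no numerics implied): under one-sided domination the stale set of the hub schedule empties in order
`(m/(tcp))·log K` steps — `K·log K/(tp)` at `m = cK` — provided the swap odds `t/((1−t)w₀)` stay below `p/4`;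
with perfect transports there is no such proviso and cold updates of total weight `1 − w₀` cost exactly the factor
`1/w₀`.  NOT CLAIMED here: anything about configurations (files 3–5 of the chapter).  Literature grade (cell rule):
OWN COMPOSITION; nothing cited as a fact; no new bib keys.
-/

noncomputable section

open Finset Function
open Literature.Probability.MarkovChains

namespace Summit.Ventures.LatticeQCDFlow.Scaling

variable {K m : ℕ} {t w₀ p q : ℝ} {Q : Finset (Fin (K + 1)) → Finset (Fin (K + 1)) → ℝ}

section Decay
variable (κ : Fin m → Fin K)

/-! ## §1 The two tunings -/

/-- **ONE-SIDED TUNING:** `0 < p ≤ 1`, `0 ≤ q ≤ 1`, `0 ≤ t ≤ 1`, `0 ≤ w₀ ≤ 1`, **`4t ≤ p(1−t)w₀`**, `1 ≤ c ≤ c_{p'}`,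
`c ≤ m` ⇒ **`(δ_{univ} Qⁿ){D ≠ ∅} ≤ ((2K + p)/p)·(1 − t·c·p/(2m))ⁿ`** (`b = p/2`, `ρ = tcp/(2m)`). [ours] -/
theorem regen_nonempty_le_oneSided (hm : 1 ≤ m) (ht0 : 0 ≤ t) (ht1 : t ≤ 1) (hw0 : 0 ≤ w₀) (hw1 : w₀ ≤ 1)
    (hp0 : 0 < p) (hp1 : p ≤ 1) (hq0 : 0 ≤ q) (hq1 : q ≤ 1) (hreg : 4 * t ≤ p * (1 - t) * w₀)
    {gbar : Fin m → Finset (Fin (K + 1)) → ℝ}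
    (hg : ∀ r D, gbar r D = if (0 : Fin (K + 1)) ∉ D then (if (κ r).succ ∉ D then (1 : ℝ) else p)
      else (if (κ r).succ ∉ D then q else 0))
    {B : Fin m → Finset (Fin (K + 1)) → Finset (Fin (K + 1))}
    (hB : ∀ r D, B r D = if (0 : Fin (K + 1)) ∉ D ∧ (κ r).succ ∉ D then D
      else insert (0 : Fin (K + 1)) (insert (κ r).succ D))
    (hQ : ∀ D D', Q D D' = ∑ r : Fin m, t / m *
        (gbar r D * (if D' = D.image (Equiv.swap (0 : Fin (K + 1)) (κ r).succ) then (1 : ℝ) else 0)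
          + (1 - gbar r D) * (if D' = B r D then (1 : ℝ) else 0))
      + (1 - t) * (w₀ * (if D' = D.erase 0 then (1 : ℝ) else 0) + (1 - w₀) * (if D' = D then (1 : ℝ) else 0)))
    {c : ℕ} (hc1 : 1 ≤ c) (hc : ∀ p' : Fin K, c ≤ (univ.filter (fun r : Fin m => κ r = p')).card) (hcm : c ≤ m)
    (n : ℕ) :
    ∑ D ∈ univ.filter (fun D : Finset (Fin (K + 1)) => D ≠ ∅), lawAt Q (Pi.single (univ : Finset (Fin (K + 1))) 1) n D
      ≤ (2 * (K : ℝ) + p) / p * (1 - t * c * p / (2 * m)) ^ n := by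
  have hmpos : (0 : ℝ) < m := Nat.cast_pos.mpr (by omega)
  have hcpos : (0 : ℝ) < c := Nat.cast_pos.mpr (by omega)
  have hcm' : (c : ℝ) ≤ m := by exact_mod_cast hcm
  have hcm1 : (c : ℝ) / m ≤ 1 := (div_le_one hmpos).mpr hcm'
  set ρ := t * c * p / (2 * m) with hρ
  have hρ0 : 0 ≤ ρ := by positivity
  have hρt : ρ ≤ t / 2 := by
    rw [hρ]
    have : t * c * p / (2 * m) = t / 2 * (c / m) * p := by field_simp
    rw [this]
    calc t / 2 * (c / m) * p ≤ t / 2 * 1 * 1 := by gcongr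
      _ = t / 2 := by ring
  have hρ1 : ρ ≤ 1 := by linarith
  have h1 : ρ ≤ t * c * (p - p / 2) / m := by rw [hρ]; apply le_of_eq; field_simp; ring
  have h2 : ρ * (p / 2) ≤ (1 - t) * w₀ * (p / 2) - t * (1 - q * (p / 2)) := by
    -- `ρ·p/2 ≤ t/2 ≤ t ≤ 2t − t ≤ (1−t)w₀p/2 − t(1 − qp/2)`
    have hqp : 0 ≤ q * (p / 2) := by positivity
    nlinarith [hρt, hp1, hp0]
  have h3 : ρ ≤ t * (1 - q * (p / 2)) * c / m := by
    have hqp : q * (p / 2) ≤ 1 / 2 := by nlinarith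
    rw [hρ]
    have : t * c * p / (2 * m) = t * (p / 2) * c / m := by field_simp
    rw [this]
    gcongr
    linarith
  have h := regen_nonempty_le κ hm ht0 ht1 hw0 hw1 hp1 hq0 hq1 hg hB hQ hc (by positivity : 0 < p / 2)
    (by linarith : p / 2 ≤ p) hρ1 h1 h2 h3 n
  have e : (1 - ρ) ^ n * ((K : ℝ) + p / 2) / (p / 2) = (2 * (K : ℝ) + p) / p * (1 - ρ) ^ n := by
    field_simp
  rw [e] at h
  exact h

/-- **PERFECT-TRANSPORT TUNING:** `p = q = 1`, `0 < t < 1`, `0 < w₀ ≤ 1`, `1 ≤ c ≤ c_{p'}`, `c ≤ m` ⇒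
**`(δ_{univ} Qⁿ){D ≠ ∅} ≤ 2(K+1)·(1 − t(1−t)w₀c/(2m))ⁿ`** (`b = 1 − (1−t)w₀/2`, `ρ = t(1−t)w₀c/(2m)`; the set
chain of `Scaling/DirtySetDecay` made lazy by cold updates of total weight `1 − w₀`). [ours] -/
theorem regen_nonempty_le_perfect (hm : 1 ≤ m) (ht0 : 0 < t) (ht1 : t < 1) (hw0 : 0 < w₀) (hw1 : w₀ ≤ 1)
    (hp : p = 1) (hq : q = 1)
    {gbar : Fin m → Finset (Fin (K + 1)) → ℝ}
    (hg : ∀ r D, gbar r D = if (0 : Fin (K + 1)) ∉ D then (if (κ r).succ ∉ D then (1 : ℝ) else p)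
      else (if (κ r).succ ∉ D then q else 0))
    {B : Fin m → Finset (Fin (K + 1)) → Finset (Fin (K + 1))}
    (hB : ∀ r D, B r D = if (0 : Fin (K + 1)) ∉ D ∧ (κ r).succ ∉ D then D
      else insert (0 : Fin (K + 1)) (insert (κ r).succ D))
    (hQ : ∀ D D', Q D D' = ∑ r : Fin m, t / m *
        (gbar r D * (if D' = D.image (Equiv.swap (0 : Fin (K + 1)) (κ r).succ) then (1 : ℝ) else 0)
          + (1 - gbar r D) * (if D' = B r D then (1 : ℝ) else 0))
      + (1 - t) * (w₀ * (if D' = D.erase 0 then (1 : ℝ) else 0) + (1 - w₀) * (if D' = D then (1 : ℝ) else 0)))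
    {c : ℕ} (hc1 : 1 ≤ c) (hc : ∀ p' : Fin K, c ≤ (univ.filter (fun r : Fin m => κ r = p')).card) (hcm : c ≤ m)
    (n : ℕ) :
    ∑ D ∈ univ.filter (fun D : Finset (Fin (K + 1)) => D ≠ ∅), lawAt Q (Pi.single (univ : Finset (Fin (K + 1))) 1) n D
      ≤ 2 * ((K : ℝ) + 1) * (1 - t * (1 - t) * w₀ * c / (2 * m)) ^ n := by
  have hmpos : (0 : ℝ) < m := Nat.cast_pos.mpr (by omega)
  have hcpos : (0 : ℝ) < c := Nat.cast_pos.mpr (by omega)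
  have hcm' : (c : ℝ) ≤ m := by exact_mod_cast hcm
  have hcm1 : (c : ℝ) / m ≤ 1 := (div_le_one hmpos).mpr hcm'
  set δ := (1 - t) * w₀ / 2 with hδ
  have hδ0 : 0 < δ := by rw [hδ]; exact div_pos (mul_pos (by linarith) hw0) (by norm_num)
  have hδ1 : δ ≤ (1 - t) / 2 := by rw [hδ]; nlinarith
  set ρ := t * (1 - t) * w₀ * c / (2 * m) with hρ
  have hρδ : ρ = t * δ * (c / m) := by rw [hρ, hδ]; field_simp
  have hρ0 : 0 ≤ ρ := by rw [hρδ]; positivity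
  have hρtδ : ρ ≤ t * δ := by
    rw [hρδ]; exact mul_le_of_le_one_right (by positivity) hcm1
  have hρ1 : ρ ≤ 1 := by nlinarith
  subst hp; subst hq
  have h1 : ρ ≤ t * c * (1 - (1 - δ)) / m := by rw [hρδ]; apply le_of_eq; field_simp; ring
  have h3 : ρ ≤ t * (1 - 1 * (1 - δ)) * c / m := by rw [hρδ]; apply le_of_eq; field_simp; ring
  have h2 : ρ * (1 - δ) ≤ (1 - t) * w₀ * (1 - δ) - t * (1 - 1 * (1 - δ)) := by
    -- `(1−t)w₀ = 2δ`; need `ρ(1−δ) + tδ ≤ 2δ(1−δ)`; use `ρ ≤ tδ` and `t(1−δ) + t ≤ 2(1−δ)`… precisely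
    -- `tδ(1−δ) + tδ ≤ 2δ(1−δ) ⇔ t(2−δ) ≤ 2(1−δ) ⇐ δ ≤ (1−t)/2`.
    have hw : (1 - t) * w₀ = 2 * δ := by rw [hδ]; ring
    rw [hw]
    nlinarith [hρtδ, hδ1, hδ0, ht0, mul_pos ht0 hδ0]
  have h := regen_nonempty_le κ hm ht0.le ht1.le hw0.le hw1 le_rfl (by norm_num) le_rfl hg hB hQ hc
    (by linarith : 0 < 1 - δ) (by linarith : 1 - δ ≤ 1) hρ1 h1 h2 h3 n
  -- `(K + b)/b ≤ 2(K+1)` for `b ≥ 1/2`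
  have hb : (1 : ℝ) / 2 ≤ 1 - δ := by linarith
  have hKb : ((K : ℝ) + (1 - δ)) / (1 - δ) ≤ 2 * ((K : ℝ) + 1) := by
    rw [div_le_iff₀ (by linarith)]
    nlinarith [(Nat.cast_nonneg K : (0 : ℝ) ≤ K)]
  calc ∑ D ∈ univ.filter (fun D : Finset (Fin (K + 1)) => D ≠ ∅),
        lawAt Q (Pi.single (univ : Finset (Fin (K + 1))) 1) n D ≤ (1 - ρ) ^ n * ((K : ℝ) + (1 - δ)) / (1 - δ) := h
    _ = (1 - ρ) ^ n * (((K : ℝ) + (1 - δ)) / (1 - δ)) := by ring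
    _ ≤ (1 - ρ) ^ n * (2 * ((K : ℝ) + 1)) := mul_le_mul_of_nonneg_left hKb (pow_nonneg (by linarith) n)
    _ = 2 * ((K : ℝ) + 1) * (1 - ρ) ^ n := by ring

/-! ## §2 The `log`-forms -/

/-- `(1 − a)ⁿ ≤ e^{−na}` and `n ≥ (1/a)·log(C/ε)` ⇒ `C·(1−a)ⁿ ≤ ε` (`0 < a ≤ 1`, `0 < C`, `0 < ε`). [ours] -/
theorem geom_le_of_ge_log {a C ε : ℝ} (ha0 : 0 < a) (ha1 : a ≤ 1) (hC : 0 < C) (hε : 0 < ε) {n : ℕ}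
    (hn : 1 / a * Real.log (C / ε) ≤ n) : C * (1 - a) ^ n ≤ ε := by
  have hna : Real.log (C / ε) ≤ n * a := by
    have h := mul_le_mul_of_nonneg_right hn ha0.le
    have e : 1 / a * Real.log (C / ε) * a = Real.log (C / ε) := by field_simp
    linarith [e]
  have hpow : (1 - a) ^ n ≤ Real.exp (-(n * a)) := by
    calc (1 - a) ^ n ≤ (Real.exp (-a)) ^ n := by
          apply pow_le_pow_left₀ (by linarith)
          have := Real.add_one_le_exp (-a); linarith
      _ = Real.exp (-(n * a)) := by rw [← Real.exp_nat_mul]; ring_nf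
  have hexp : Real.exp (-(n * a)) ≤ ε / C := by
    calc Real.exp (-(n * a)) ≤ Real.exp (-Real.log (C / ε)) := Real.exp_le_exp.mpr (by linarith)
      _ = ε / C := by rw [Real.exp_neg, Real.exp_log (by positivity), inv_div]
  calc C * (1 - a) ^ n ≤ C * (ε / C) := by gcongr; exact hpow.trans hexp
    _ = ε := by field_simp

/-- **ONE-SIDED, `log`-form:** `n ≥ (2m/(tcp))·log((2K+p)/(pε))` ⇒ `(δ_{univ} Qⁿ){D ≠ ∅} ≤ ε`. [ours] -/
theorem regen_nonempty_le_oneSided_of_ge_log (hm : 1 ≤ m) (ht0 : 0 < t) (ht1 : t ≤ 1) (hw0 : 0 ≤ w₀)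
    (hw1 : w₀ ≤ 1) (hp0 : 0 < p) (hp1 : p ≤ 1) (hq0 : 0 ≤ q) (hq1 : q ≤ 1) (hreg : 4 * t ≤ p * (1 - t) * w₀)
    {gbar : Fin m → Finset (Fin (K + 1)) → ℝ}
    (hg : ∀ r D, gbar r D = if (0 : Fin (K + 1)) ∉ D then (if (κ r).succ ∉ D then (1 : ℝ) else p)
      else (if (κ r).succ ∉ D then q else 0))
    {B : Fin m → Finset (Fin (K + 1)) → Finset (Fin (K + 1))}
    (hB : ∀ r D, B r D = if (0 : Fin (K + 1)) ∉ D ∧ (κ r).succ ∉ D then D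
      else insert (0 : Fin (K + 1)) (insert (κ r).succ D))
    (hQ : ∀ D D', Q D D' = ∑ r : Fin m, t / m *
        (gbar r D * (if D' = D.image (Equiv.swap (0 : Fin (K + 1)) (κ r).succ) then (1 : ℝ) else 0)
          + (1 - gbar r D) * (if D' = B r D then (1 : ℝ) else 0))
      + (1 - t) * (w₀ * (if D' = D.erase 0 then (1 : ℝ) else 0) + (1 - w₀) * (if D' = D then (1 : ℝ) else 0)))
    {c : ℕ} (hc1 : 1 ≤ c) (hc : ∀ p' : Fin K, c ≤ (univ.filter (fun r : Fin m => κ r = p')).card) (hcm : c ≤ m)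
    {ε : ℝ} (hε : 0 < ε) {n : ℕ}
    (hn : 2 * (m : ℝ) / (t * c * p) * Real.log ((2 * (K : ℝ) + p) / (p * ε)) ≤ n) :
    ∑ D ∈ univ.filter (fun D : Finset (Fin (K + 1)) => D ≠ ∅), lawAt Q (Pi.single (univ : Finset (Fin (K + 1))) 1) n D
      ≤ ε := by
  have hmpos : (0 : ℝ) < m := Nat.cast_pos.mpr (by omega)
  have hcpos : (0 : ℝ) < c := Nat.cast_pos.mpr (by omega)
  have hcm' : (c : ℝ) ≤ m := by exact_mod_cast hcm
  refine (regen_nonempty_le_oneSided κ hm ht0.le ht1 hw0 hw1 hp0 hp1 hq0 hq1 hreg hg hB hQ hc1 hc hcm n).trans ?_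
  have ha0 : 0 < t * c * p / (2 * m) := by positivity
  have ha1 : t * c * p / (2 * m) ≤ 1 := by
    rw [div_le_one (by positivity)]
    have : t * c * p ≤ 1 * m * 1 := by
      have h1 : t * c ≤ 1 * m := by nlinarith
      nlinarith
    linarith
  have hC : 0 < (2 * (K : ℝ) + p) / p := by positivity
  refine geom_le_of_ge_log ha0 ha1 hC hε ?_
  have e1 : 1 / (t * c * p / (2 * m)) = 2 * (m : ℝ) / (t * c * p) := by field_simp
  have e2 : (2 * (K : ℝ) + p) / p / ε = (2 * (K : ℝ) + p) / (p * ε) := by rw [div_div]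
  rw [e1, e2]; exact hn

/-- **PERFECT TRANSPORTS, `log`-form:** `n ≥ (2m/(t(1−t)w₀c))·log(2(K+1)/ε)` ⇒ `(δ_{univ} Qⁿ){D ≠ ∅} ≤ ε`. [ours] -/
theorem regen_nonempty_le_perfect_of_ge_log (hm : 1 ≤ m) (ht0 : 0 < t) (ht1 : t < 1) (hw0 : 0 < w₀) (hw1 : w₀ ≤ 1)
    (hp : p = 1) (hq : q = 1)
    {gbar : Fin m → Finset (Fin (K + 1)) → ℝ}
    (hg : ∀ r D, gbar r D = if (0 : Fin (K + 1)) ∉ D then (if (κ r).succ ∉ D then (1 : ℝ) else p)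
      else (if (κ r).succ ∉ D then q else 0))
    {B : Fin m → Finset (Fin (K + 1)) → Finset (Fin (K + 1))}
    (hB : ∀ r D, B r D = if (0 : Fin (K + 1)) ∉ D ∧ (κ r).succ ∉ D then D
      else insert (0 : Fin (K + 1)) (insert (κ r).succ D))
    (hQ : ∀ D D', Q D D' = ∑ r : Fin m, t / m *
        (gbar r D * (if D' = D.image (Equiv.swap (0 : Fin (K + 1)) (κ r).succ) then (1 : ℝ) else 0)
          + (1 - gbar r D) * (if D' = B r D then (1 : ℝ) else 0))
      + (1 - t) * (w₀ * (if D' = D.erase 0 then (1 : ℝ) else 0) + (1 - w₀) * (if D' = D then (1 : ℝ) else 0)))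
    {c : ℕ} (hc1 : 1 ≤ c) (hc : ∀ p' : Fin K, c ≤ (univ.filter (fun r : Fin m => κ r = p')).card) (hcm : c ≤ m)
    {ε : ℝ} (hε : 0 < ε) {n : ℕ}
    (hn : 2 * (m : ℝ) / (t * (1 - t) * w₀ * c) * Real.log (2 * ((K : ℝ) + 1) / ε) ≤ n) :
    ∑ D ∈ univ.filter (fun D : Finset (Fin (K + 1)) => D ≠ ∅), lawAt Q (Pi.single (univ : Finset (Fin (K + 1))) 1) n D
      ≤ ε := by
  have hmpos : (0 : ℝ) < m := Nat.cast_pos.mpr (by omega)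
  have hcpos : (0 : ℝ) < c := Nat.cast_pos.mpr (by omega)
  have hcm' : (c : ℝ) ≤ m := by exact_mod_cast hcm
  refine (regen_nonempty_le_perfect κ hm ht0 ht1 hw0 hw1 hp hq hg hB hQ hc1 hc hcm n).trans ?_
  have h1t : 0 < 1 - t := by linarith
  have ha0 : 0 < t * (1 - t) * w₀ * c / (2 * m) := by positivity
  have ha1 : t * (1 - t) * w₀ * c / (2 * m) ≤ 1 := by
    rw [div_le_one (by positivity)]
    have h1 : t * (1 - t) ≤ 1 := by nlinarith
    have h2 : t * (1 - t) * w₀ ≤ 1 := by nlinarith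
    nlinarith
  have hC : 0 < 2 * ((K : ℝ) + 1) := by positivity
  refine geom_le_of_ge_log ha0 ha1 hC hε ?_
  have e1 : 1 / (t * (1 - t) * w₀ * c / (2 * m)) = 2 * (m : ℝ) / (t * (1 - t) * w₀ * c) := by field_simp
  rw [e1]; exact hn

end Decay

end Summit.Ventures.LatticeQCDFlow.Scaling

end
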